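import Mathlib
import Literature.Analysis.Complex.BacklundTrick
import HarnessLib

/-!
# Zhang (2022), §4 p. 9: (4.11) and the displays of the proofs of Lemma 4.5 (Case 2) and
# Lemma 4.6 ((4.12)) — logarithmic derivative of `ℬ`, its integration along a segment,
# "`log|ℬ(s)| = Re∫ℬ′/ℬ < (1/2−σ)log P`", "`|𝒜(s)| > 1 − P^{1/2−σ} + O(𝓛^{−100}) ≫ α`",
# "`ℬ(1/2+iγ+w)/ℬ(ρ) = exp{∫ℬ′/ℬ} = P^{−2w} + O(α𝓛)`" — kernel-checked in structural form

Topic `Literature/NumberTheory/LFunctions/Zhang2022` (Landau–Siegel autopsy tree; verdict-neutral).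
Y. Zhang, *Discrete mean estimates and the Landau–Siegel zero*, arXiv:2211.02515v1 (2022) — **an
unrefereed manuscript, a claimed result under adjudication** (cell pub-zhang: audit + repair census
of arXiv:2211.02515; no claim about Landau–Siegel) — §4 p. 9:

> […] `𝒜(s,ψ) = 1 + ℬ(s,ψ) + O(𝓛^{−100})` (4.10) for `s ∈ Ω₃`, where `ℬ(s,ψ) = Z̃(s,ψ)F(1−s,ψ̄)/F(s,ψ)`.
> Lemma 4.5. If `1/2 + α² < σ < 1`, `|t − 2πt₀| < 𝓛₁ + 2`, then `𝒜(s,ψ) ≠ 0`. Proof. […]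
> Case 2. `1/2 + α² ≤ σ < 1/2 + 𝓛⁻¹`. Assume `1/2 ≤ σ′ ≤ σ`. Then both `σ′+it` and `1 − \overline{(σ′+it)}`
> lie in `Ω₂`. Hence, by Lemma 4.3 and (4.6),
> `ℬ′/ℬ(σ′+it,ψ) = Z̃′/Z̃(σ′+it,ψ) − F′/F(σ′+it,ψ) − F′/F(1−σ′−it,ψ̄) = −2log P + O(𝓛)`.   (4.11)
> Since `|ℬ(1/2+it,ψ)| = 1`, it follows that
> `log|ℬ(s,ψ)| = Re{∫_{1/2}^σ ℬ′/ℬ(σ′+it)dσ} < (1/2−σ)log P`. Hence, by (4.10),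
> `|𝒜(s,ψ)| > 1 − P^{1/2−σ} + O(𝓛^{−100}) ≫ α`. □
> [Lemma 4.6, proof of (4.12):] Assume `|w| < 2α`. By (4.10) we have
> `𝒜(1/2+iγ+w,ψ) − (1−P^{−2w}) = ℬ(1/2+iγ+w,ψ) + P^{−2w} + O(𝓛^{−100})`. Noting that both `s` and
> `1−s` are in `Ω₂` if `s` lies on the segment connecting `ρ` and `1/2+iγ+w`, by (4.11) we have
> `ℬ(1/2+iγ+w,ψ)/ℬ(ρ,ψ) = exp{∫_ρ^{1/2+iγ+w} ℬ′/ℬ(s,ψ)ds} = exp{−2w log P + O(α𝓛)} = P^{−2w} + O(α𝓛)`.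
> Since `ℬ(ρ,ψ) = −1 + O(𝓛^{−100})` by (4.10), the estimate (4.12) follows.

(`α = π/log P`, `P = exp{𝓛⁹}` (2.6), (2.10).) Lemma 4.3 (`F′/F = O(𝓛)`) and (4.6)
(`Z̃′/Z̃ = −2log P + O(𝓛)`) are the INPUTS of (4.11); (4.10) is the input of the last two steps. This
file PROVES the displayed inferences for arbitrary holomorphic functions in place of `ℬ`, `𝒜`, with
every implied constant explicit (namespace `Lemma45`):

* `Lemma45.logDeriv_calB` — **(4.11), first line, EXACT**: for `ℬ(s) = Z̃(s)F̄(1−s)/F(s)` with the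
  three factors differentiable and non-zero at the relevant points,
  `ℬ′/ℬ(s) = Z̃′/Z̃(s) − F̄′/F̄(1−s) − F′/F(s)` (Mathlib `logDeriv`); and `Lemma45.norm_logDeriv_calB_le`
  — the second line's bookkeeping: `|Z̃′/Z̃ + 2log P| ≤ E₀`, `|F′/F| ≤ E₁`, `|F̄′/F̄(1−s)| ≤ E₂`
  `⇒ |ℬ′/ℬ(s) + 2log P| ≤ E₀ + E₁ + E₂`;
* `Lemma45.log_norm_eq_re_integral` — **"Since `|ℬ(1/2+it)| = 1`, `log|ℬ(s)| = Re∫_{1/2}^σ ℬ′/ℬ(σ′+it)dσ′`"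
  EXACT** (for `ℬ` analytic and zero-free on the horizontal segment; the tree's
  `Literature.Analysis.Complex.eq_mul_exp_integral_logDeriv`); `Lemma45.log_norm_le_of_re_logDeriv_le`
  — **"`< (1/2−σ)log P`"**: if `Re ℬ′/ℬ ≤ −K` on the segment then `log|ℬ(s)| ≤ −K(σ − 1/2)`, so
  `|ℬ(s)| ≤ e^{−K(σ−1/2)}` (with (4.11): `K = 2log P − O(𝓛) > log P`);
* `Lemma45.norm_calA_ge` — **"`|𝒜(s)| > 1 − P^{1/2−σ} + O(𝓛^{−100})`"**: `|𝒜 − 1 − ℬ| ≤ E`, `|ℬ| ≤ B`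
  `⇒ |𝒜| ≥ 1 − B − E`; and `Lemma45.rpow_le_exp_neg_pi_alpha`, `Lemma45.norm_calA_ge_alpha` —
  **"`≫ α`"**: for `σ ≥ 1/2 + α²`, `P^{1/2−σ} ≤ P^{−α²} = e^{−πα}` and `1 − e^{−πα} ≥ πα/(1+πα) ≥ πα/2`
  once `πα ≤ 1`, so `|𝒜(s)| ≥ πα/2 − E`;
* `Lemma45.eq_mul_exp_integral_logDeriv_segment` — **"`ℬ(1/2+iγ+w)/ℬ(ρ) = exp{∫_ρ^{ρ+w} ℬ′/ℬ ds}`"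
  EXACT** along a segment in ANY direction: `g(a+w) = g(a)·exp(w∫₀¹ g′/g(a+xw)dx)` for `g` analytic
  and zero-free on `[a, a+w]`;
* `Lemma45.norm_integral_sub_le`, `Lemma45.exists_eq_mul_exp`, `Lemma45.norm_sub_mul_exp_le` —
  **"`= exp{−2w log P + O(α𝓛)} = P^{−2w} + O(α𝓛)`"**: if `|g′/g − m| ≤ E` on the segment then
  `g(a+w) = g(a)e^{mw}e^{η}` with `|η| ≤ E|w|`, and, when `E|w| ≤ 1`,
  `|g(a+w) − g(a)e^{mw}| ≤ 2E|w|·|g(a)|·|e^{mw}|`; with `m = −2log P`, `|w| < 2α`: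
  `|e^{mw}| = |P^{−2w}| ≤ e^{4π}` (`Lemma45.norm_Pw_le_of_norm_lt`);
* `Lemma45.norm_calB_add_one_le`, `Lemma45.ineq412_assembly` — **"Since `ℬ(ρ) = −1 + O(𝓛^{−100})` by
  (4.10), the estimate (4.12) follows"**: `𝒜(ρ) = 0`, `|𝒜 − 1 − ℬ| ≤ E` at `ρ` and `ρ+w`,
  `|ℬ(ρ+w) − ℬ(ρ)P^{−2w}| ≤ R` `⇒ |ℬ(ρ) + 1| ≤ E` and `|𝒜(ρ+w) − (1 − P^{−2w})| ≤ E + R + E|P^{−2w}|`;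
  and `Lemma45.ineq412` — **(4.12) assembled with its constant**: `≤ E(1 + e^{4π}) + 2e^{4π}(1+E)·C|w|`
  from (4.10)'s `E`, (4.11)'s `C` and `|w| < 2α` — "the implied constant being independent of `c′`".

What is NOT asserted: Lemma 4.3, (4.5)/(4.6), (4.10) (they rest on Lemmas 4.1–4.4 and the mean
values (3.4)–(3.6)); "`|ℬ(1/2+it,ψ)| = 1`" itself (it is `|Z̃| = 1` on the critical line, tree
`Zhang2022/Section4TildeZ`, `Section2AnalyticRootY`, times `|F(1−s,ψ̄)| = |F(s,ψ)|` at `σ = 1/2`);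
Lemma 4.5's conclusion `𝒜 ≠ 0` for `ψ ∈ Ψ₁` as such; Rouché (see `Zhang2022/Section4RoucheCircle` for
the comparison function `1 − P^{−2w}` and (4.13)). Nothing about Theorems 1–2 of the source is
stated or implied; nothing here bears on the cell's verdict on (8.24).

## References

* Y. Zhang, arXiv:2211.02515v1 (2022), §4 p. 9: (4.10), Lemma 4.5 (proof, Case 2: (4.11) and the
  two displays after it), Lemma 4.6 (proof: the three displays deriving (4.12)); (2.6), (2.10).
  [cite: Zhang2022LandauSiegel, §4 Lemma 4.5 (proof), (4.11)]
* The tree's `Literature/Analysis/Complex/BacklundTrick.lean` (`eq_mul_exp_integral_logDeriv`, the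
  log-derivative integrates to the quotient along a horizontal segment). [folklore]
-/

noncomputable section

open Complex Real Set MeasureTheory intervalIntegral

namespace Literature.NumberTheory.LFunctions.Zhang2022

namespace Lemma45

/-! ### (4.11): the logarithmic derivative of `ℬ(s) = Z̃(s)·F̄(1−s)/F(s)` -/

/-- **(4.11), first line, EXACT**: `ℬ′/ℬ(s) = Z̃′/Z̃(s) − F′/F(s) − F̄′/F̄(1−s)` for
`ℬ(s) = Z̃(s)F̄(1−s)/F(s)` (`F̄ = F(·,ψ̄)`), whenever the three factors are differentiable and
non-zero at `s`, `1−s`, `s` respectively. [cite: Zhang2022LandauSiegel, §4 Lemma 4.5 (proof), (4.11)] -/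
theorem logDeriv_calB {Z Fb F : ℂ → ℂ} {s : ℂ} (hZ0 : Z s ≠ 0) (hFb0 : Fb (1 - s) ≠ 0)
    (hF0 : F s ≠ 0) (hZ : DifferentiableAt ℂ Z s) (hFb : DifferentiableAt ℂ Fb (1 - s))
    (hF : DifferentiableAt ℂ F s) :
    logDeriv (fun z => Z z * Fb (1 - z) / F z) s
      = logDeriv Z s - logDeriv F s - logDeriv Fb (1 - s) := by
  have h1 : DifferentiableAt ℂ (fun z : ℂ => 1 - z) s := differentiableAt_id.const_sub 1
  have hcomp : DifferentiableAt ℂ (fun z => Fb (1 - z)) s := hFb.comp s h1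
  have hmul : DifferentiableAt ℂ (fun z => Z z * Fb (1 - z)) s := hZ.mul hcomp
  rw [logDeriv_div (f := fun z => Z z * Fb (1 - z)) (g := F) s (mul_ne_zero hZ0 hFb0) hF0 hmul hF,
    logDeriv_mul (f := Z) (g := fun z => Fb (1 - z)) s hZ0 hFb0 hZ hcomp]
  have hc : logDeriv (fun z => Fb (1 - z)) s = -logDeriv Fb (1 - s) := by
    have h2 := logDeriv_comp (f := Fb) (g := fun z : ℂ => 1 - z) (x := s) hFb h1
    have hd : deriv (fun z : ℂ => 1 - z) s = -1 := by
      rw [deriv_const_sub, deriv_id'']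
    rw [Function.comp_def] at h2
    rw [h2, hd]
    ring
  rw [hc]
  ring

/-- **(4.11), second line's bookkeeping**: if `|Z̃′/Z̃(s) + 2log P| ≤ E₀` ((4.6)), `|F′/F(s)| ≤ E₁` and
`|F̄′/F̄(1−s)| ≤ E₂` (Lemma 4.3 at `s` and at `1 − s̄`' mirror point), then
`|ℬ′/ℬ(s) + 2log P| ≤ E₀ + E₁ + E₂` — "`= −2log P + O(𝓛)`".
[cite: Zhang2022LandauSiegel, §4 Lemma 4.5 (proof), (4.11)] -/
theorem norm_logDeriv_calB_le {Z Fb F : ℂ → ℂ} {s : ℂ} {lP E₀ E₁ E₂ : ℝ} (hZ0 : Z s ≠ 0)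
    (hFb0 : Fb (1 - s) ≠ 0) (hF0 : F s ≠ 0) (hZ : DifferentiableAt ℂ Z s)
    (hFb : DifferentiableAt ℂ Fb (1 - s)) (hF : DifferentiableAt ℂ F s)
    (h0 : ‖logDeriv Z s + 2 * lP‖ ≤ E₀) (h1 : ‖logDeriv F s‖ ≤ E₁)
    (h2 : ‖logDeriv Fb (1 - s)‖ ≤ E₂) :
    ‖logDeriv (fun z => Z z * Fb (1 - z) / F z) s + 2 * lP‖ ≤ E₀ + E₁ + E₂ := by
  rw [logDeriv_calB hZ0 hFb0 hF0 hZ hFb hF]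
  have : logDeriv Z s - logDeriv F s - logDeriv Fb (1 - s) + 2 * lP
      = (logDeriv Z s + 2 * lP) - logDeriv F s - logDeriv Fb (1 - s) := by ring
  rw [this]
  calc ‖logDeriv Z s + 2 * lP - logDeriv F s - logDeriv Fb (1 - s)‖
      ≤ ‖logDeriv Z s + 2 * lP - logDeriv F s‖ + ‖logDeriv Fb (1 - s)‖ := norm_sub_le _ _
    _ ≤ (‖logDeriv Z s + 2 * lP‖ + ‖logDeriv F s‖) + ‖logDeriv Fb (1 - s)‖ := by
        gcongr; exact norm_sub_le _ _
    _ ≤ E₀ + E₁ + E₂ := by linarith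

/-! ### Lemma 4.5, Case 2: integrating `Re ℬ′/ℬ` along `[1/2, σ] × {t}` -/

/-- The log-derivative is continuous along a horizontal segment on which the function is analytic
and zero-free. [folklore] -/
private lemma continuousOn_logDeriv_horizontal {h : ℂ → ℂ} {t u v : ℝ}
    (hh : ∀ x ∈ Icc u v, AnalyticAt ℂ h (x + t * I)) (h0 : ∀ x ∈ Icc u v, h (x + t * I) ≠ 0) :
    ContinuousOn (fun x : ℝ => deriv h (x + t * I) / h (x + t * I)) (Icc u v) := by
  intro x hx
  have han := hh x hx
  have hline : ContinuousAt (fun x : ℝ => (x : ℂ) + t * I) x :=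
    (Complex.continuous_ofReal.add continuous_const).continuousAt
  have h1 : ContinuousAt (fun x : ℝ => deriv h (x + t * I)) x :=
    ContinuousAt.comp (f := fun x : ℝ => (x : ℂ) + t * I) han.deriv.continuousAt hline
  have h2 : ContinuousAt (fun x : ℝ => h (x + t * I)) x :=
    ContinuousAt.comp (f := fun x : ℝ => (x : ℂ) + t * I) han.continuousAt hline
  exact (h1.div h2 (h0 x hx)).continuousWithinAt

/-- **"Since `|ℬ(1/2+it,ψ)| = 1`, it follows that `log|ℬ(s,ψ)| = Re{∫_{1/2}^σ ℬ′/ℬ(σ′+it)dσ′}`"**,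
EXACT: for `h` analytic and zero-free on the segment `[σ₀, σ] × {t}` with `|h(σ₀+it)| = 1`
(`σ₀ = 1/2`), `log|h(σ+it)| = Re∫_{σ₀}^σ h′/h(x+it)dx`.
[cite: Zhang2022LandauSiegel, §4 Lemma 4.5 (proof)] -/
theorem log_norm_eq_re_integral {h : ℂ → ℂ} {t σ₀ σ : ℝ} (hσ : σ₀ ≤ σ)
    (hh : ∀ x ∈ Icc σ₀ σ, AnalyticAt ℂ h (x + t * I)) (h0 : ∀ x ∈ Icc σ₀ σ, h (x + t * I) ≠ 0)
    (h1 : ‖h (σ₀ + t * I)‖ = 1) :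
    Real.log ‖h (σ + t * I)‖ = (∫ x in σ₀..σ, deriv h (x + t * I) / h (x + t * I)).re := by
  have key := Literature.Analysis.Complex.eq_mul_exp_integral_logDeriv hσ hh h0
  rw [key, norm_mul, h1, one_mul, Complex.norm_exp, Real.log_exp]

/-- **"`log|ℬ(s,ψ)| = Re{∫…} < (1/2 − σ)log P`"**: if in addition `Re h′/h(x+it) ≤ −K` for
`x ∈ [σ₀, σ]` (by (4.11): `−K = −2log P + O(𝓛)`), then `log|h(σ+it)| ≤ −K(σ − σ₀)`.
[cite: Zhang2022LandauSiegel, §4 Lemma 4.5 (proof)] -/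
theorem log_norm_le_of_re_logDeriv_le {h : ℂ → ℂ} {t σ₀ σ K : ℝ} (hσ : σ₀ ≤ σ)
    (hh : ∀ x ∈ Icc σ₀ σ, AnalyticAt ℂ h (x + t * I)) (h0 : ∀ x ∈ Icc σ₀ σ, h (x + t * I) ≠ 0)
    (h1 : ‖h (σ₀ + t * I)‖ = 1)
    (hK : ∀ x ∈ Icc σ₀ σ, (deriv h (x + t * I) / h (x + t * I)).re ≤ -K) :
    Real.log ‖h (σ + t * I)‖ ≤ -K * (σ - σ₀) := by
  rw [log_norm_eq_re_integral hσ hh h0 h1]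
  set f : ℝ → ℂ := fun x => deriv h (x + t * I) / h (x + t * I) with hf
  have hcont : ContinuousOn f (Icc σ₀ σ) := continuousOn_logDeriv_horizontal hh h0
  have hint : IntervalIntegrable f volume σ₀ σ := hcont.intervalIntegrable_of_Icc hσ
  have hre : (∫ x in σ₀..σ, f x).re = ∫ x in σ₀..σ, (f x).re := by
    have h2 := Complex.reCLM.intervalIntegral_comp_comm hint
    simpa using h2.symm
  rw [hre]
  have hcre : ContinuousOn (fun x => (f x).re) (Icc σ₀ σ) :=
    Complex.continuous_re.comp_continuousOn hcont
  have hint' : IntervalIntegrable (fun x => (f x).re) volume σ₀ σ :=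
    hcre.intervalIntegrable_of_Icc hσ
  calc ∫ x in σ₀..σ, (f x).re ≤ ∫ x in σ₀..σ, (-K : ℝ) :=
        intervalIntegral.integral_mono_on hσ hint' intervalIntegrable_const hK
    _ = -K * (σ - σ₀) := by rw [intervalIntegral.integral_const, smul_eq_mul]; ring

/-- The exponentiated form: `|h(σ+it)| ≤ e^{−K(σ−σ₀)}` — with `K > log P` this is
"`|ℬ(s)| < P^{1/2−σ}`". [cite: Zhang2022LandauSiegel, §4 Lemma 4.5 (proof)] -/
theorem norm_le_exp_of_re_logDeriv_le {h : ℂ → ℂ} {t σ₀ σ K : ℝ} (hσ : σ₀ ≤ σ)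
    (hh : ∀ x ∈ Icc σ₀ σ, AnalyticAt ℂ h (x + t * I)) (h0 : ∀ x ∈ Icc σ₀ σ, h (x + t * I) ≠ 0)
    (h1 : ‖h (σ₀ + t * I)‖ = 1)
    (hK : ∀ x ∈ Icc σ₀ σ, (deriv h (x + t * I) / h (x + t * I)).re ≤ -K) :
    ‖h (σ + t * I)‖ ≤ Real.exp (-K * (σ - σ₀)) := by
  have hpos : 0 < ‖h (σ + t * I)‖ := norm_pos_iff.mpr (h0 σ ⟨hσ, le_rfl⟩)
  have := log_norm_le_of_re_logDeriv_le hσ hh h0 h1 hK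
  calc ‖h (σ + t * I)‖ = Real.exp (Real.log ‖h (σ + t * I)‖) := (Real.exp_log hpos).symm
    _ ≤ Real.exp (-K * (σ - σ₀)) := Real.exp_le_exp.mpr this

/-- `e^{−K(σ−1/2)} ≤ P^{1/2−σ}` when `K ≥ log P` and `σ ≥ 1/2` (the comparison used with (4.11),
where `K = 2log P − O(𝓛) > log P`). [cite: Zhang2022LandauSiegel, §4 Lemma 4.5 (proof)] -/
theorem exp_neg_le_rpow {P K σ₀ σ : ℝ} (hP : 0 < P) (hK : Real.log P ≤ K) (hσ : σ₀ ≤ σ) :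
    Real.exp (-K * (σ - σ₀)) ≤ P ^ (σ₀ - σ) := by
  rw [Real.rpow_def_of_pos hP]
  apply Real.exp_le_exp.mpr
  nlinarith

/-! ### Lemma 4.5, Case 2: "`|𝒜(s)| > 1 − P^{1/2−σ} + O(𝓛^{−100}) ≫ α`" -/

/-- **"Hence, by (4.10), `|𝒜(s,ψ)| > 1 − P^{1/2−σ} + O(𝓛^{−100})`"**: if `|𝒜 − 1 − ℬ| ≤ E` ((4.10)) and
`|ℬ| ≤ B`, then `|𝒜| ≥ 1 − B − E`. [cite: Zhang2022LandauSiegel, §4 Lemma 4.5 (proof)] -/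
theorem norm_calA_ge {A B : ℂ} {E b : ℝ} (h410 : ‖A - 1 - B‖ ≤ E) (hB : ‖B‖ ≤ b) :
    1 - b - E ≤ ‖A‖ := by
  have h1 : ‖(1 : ℂ) + B‖ - ‖(1 : ℂ) + B - A‖ ≤ ‖A‖ := by
    have := norm_sub_norm_le ((1 : ℂ) + B) ((1 : ℂ) + B - A)
    rwa [sub_sub_cancel] at this
  have h2 : ‖(1 : ℂ) + B - A‖ = ‖A - 1 - B‖ := by
    rw [← norm_neg]; congr 1; ring
  have h3 : 1 - ‖B‖ ≤ ‖(1 : ℂ) + B‖ := by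
    have := norm_sub_norm_le (1 : ℂ) (-B)
    rw [norm_one, norm_neg, sub_neg_eq_add] at this
    exact this
  linarith

/-- **"`≫ α`"**, first half: for `σ ≥ 1/2 + α²` and `P > 1`, `P^{1/2−σ} ≤ P^{−α²} = e^{−α²log P}`, and
with `α = π/log P` (2.10), `α²log P = πα`. [cite: Zhang2022LandauSiegel, §4 Lemma 4.5 (proof)] -/
theorem rpow_le_exp_neg_pi_alpha {P σ : ℝ} (hP : 1 < P) (hσ : 1 / 2 + (Real.pi / Real.log P) ^ 2 ≤ σ) :
    P ^ (1 / 2 - σ) ≤ Real.exp (-(Real.pi * (Real.pi / Real.log P))) := by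
  have hlog : 0 < Real.log P := Real.log_pos hP
  rw [Real.rpow_def_of_pos (by linarith)]
  apply Real.exp_le_exp.mpr
  have h1 : Real.log P * (1 / 2 - σ) ≤ Real.log P * (-(Real.pi / Real.log P) ^ 2) :=
    mul_le_mul_of_nonneg_left (by linarith) hlog.le
  have h2 : Real.log P * (-(Real.pi / Real.log P) ^ 2) = -(Real.pi * (Real.pi / Real.log P)) := by
    field_simp
  linarith

/-- The two halves combined in the manuscript's form: for `1/2 + α² ≤ σ`, `πα ≤ 1`, `|𝒜 − 1 − ℬ| ≤ E`
and `|ℬ| ≤ P^{1/2−σ}`: `|𝒜(s)| ≥ πα/2 − E` ("`≫ α`", `α = π/log P`).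
[cite: Zhang2022LandauSiegel, §4 Lemma 4.5 (proof)] -/
theorem norm_calA_ge_alpha {A B : ℂ} {P σ E : ℝ} (hP : 1 < P)
    (hσ : 1 / 2 + (Real.pi / Real.log P) ^ 2 ≤ σ) (hα : Real.pi * (Real.pi / Real.log P) ≤ 1)
    (h410 : ‖A - 1 - B‖ ≤ E) (hB : ‖B‖ ≤ P ^ (1 / 2 - σ)) :
    Real.pi * (Real.pi / Real.log P) / 2 - E ≤ ‖A‖ := by
  set x : ℝ := Real.pi * (Real.pi / Real.log P) with hx
  have hx0 : 0 ≤ x := by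
    have := Real.log_pos hP
    positivity
  have h1 := norm_calA_ge h410 hB
  have h2 := rpow_le_exp_neg_pi_alpha hP hσ
  -- `1 − e^{−x} ≥ x/(1+x) ≥ x/2` for `0 ≤ x ≤ 1` (tree: `div_one_add_le_one_sub_exp_neg`)
  have h3 : x / (1 + x) ≤ 1 - Real.exp (-x) := by
    have h5 : Real.exp (-x) ≤ 1 / (1 + x) := by
      rw [Real.exp_neg, one_div]
      exact inv_anti₀ (by linarith) (by linarith [Real.add_one_le_exp x])
    have h6 : x / (1 + x) = 1 - 1 / (1 + x) := by
      field_simp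
      ring
    linarith
  have h4 : x / 2 ≤ x / (1 + x) := by
    rw [div_le_div_iff₀ (by norm_num) (by linarith)]
    nlinarith
  rw [← hx] at h2
  linarith

/-! ### Lemma 4.6: integrating `ℬ′/ℬ` along the segment from `ρ` to `1/2 + iγ + w` -/

/-- The log-derivative is continuous along a segment (any direction) on which the function is
analytic and zero-free. [folklore] -/
private lemma continuousOn_logDeriv_segment {g : ℂ → ℂ} {a w : ℂ}
    (hg : ∀ x ∈ Icc (0 : ℝ) 1, AnalyticAt ℂ g (a + x * w))
    (h0 : ∀ x ∈ Icc (0 : ℝ) 1, g (a + x * w) ≠ 0) :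
    ContinuousOn (fun x : ℝ => deriv g (a + x * w) / g (a + x * w)) (Icc (0 : ℝ) 1) := by
  intro x hx
  have han := hg x hx
  have hline : ContinuousAt (fun x : ℝ => a + (x : ℂ) * w) x :=
    (continuous_const.add (Complex.continuous_ofReal.mul continuous_const)).continuousAt
  have h1 : ContinuousAt (fun x : ℝ => deriv g (a + x * w)) x :=
    ContinuousAt.comp (f := fun x : ℝ => a + (x : ℂ) * w) han.deriv.continuousAt hline
  have h2 : ContinuousAt (fun x : ℝ => g (a + x * w)) x :=
    ContinuousAt.comp (f := fun x : ℝ => a + (x : ℂ) * w) han.continuousAt hline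
  exact (h1.div h2 (h0 x hx)).continuousWithinAt

/-- **"`ℬ(1/2+iγ+w,ψ)/ℬ(ρ,ψ) = exp{∫_ρ^{1/2+iγ+w} ℬ′/ℬ(s,ψ)ds}`"**, EXACT, along a segment in any
direction: if `g` is analytic and zero-free at every point `a + xw`, `x ∈ [0,1]`, then
`g(a+w) = g(a)·exp(w∫₀¹ g′/g(a+xw)dx)`. [cite: Zhang2022LandauSiegel, §4 Lemma 4.6 (proof)] -/
theorem eq_mul_exp_integral_logDeriv_segment {g : ℂ → ℂ} {a w : ℂ}
    (hg : ∀ x ∈ Icc (0 : ℝ) 1, AnalyticAt ℂ g (a + x * w))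
    (h0 : ∀ x ∈ Icc (0 : ℝ) 1, g (a + x * w) ≠ 0) :
    g (a + w) = g a * Complex.exp (w * ∫ x in (0 : ℝ)..1, deriv g (a + x * w) / g (a + x * w)) := by
  set h : ℂ → ℂ := fun ζ => g (a + ζ * w) with hh
  have hpt : ∀ x : ℝ, a + ((x : ℂ) + ((0 : ℝ) : ℂ) * I) * w = a + x * w := by
    intro x; push_cast; ring
  have hval : ∀ x : ℝ, h ((x : ℂ) + ((0 : ℝ) : ℂ) * I) = g (a + x * w) := by
    intro x; simp only [hh]; rw [hpt]
  have haff : ∀ ζ : ℂ, HasDerivAt (fun ζ : ℂ => a + ζ * w) w ζ := by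
    intro ζ
    simpa using ((hasDerivAt_id ζ).mul_const w).const_add a
  have han : ∀ x ∈ Icc (0 : ℝ) 1, AnalyticAt ℂ h ((x : ℂ) + ((0 : ℝ) : ℂ) * I) := by
    intro x hx
    have h1 : AnalyticAt ℂ (fun ζ : ℂ => a + ζ * w) ((x : ℂ) + ((0 : ℝ) : ℂ) * I) := by fun_prop
    exact (hg x hx).comp_of_eq h1 (hpt x)
  have hne : ∀ x ∈ Icc (0 : ℝ) 1, h ((x : ℂ) + ((0 : ℝ) : ℂ) * I) ≠ 0 := by
    intro x hx; rw [hval]; exact h0 x hx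
  have hder : ∀ x ∈ Icc (0 : ℝ) 1,
      deriv h ((x : ℂ) + ((0 : ℝ) : ℂ) * I) = w * deriv g (a + x * w) := by
    intro x hx
    have hgd : HasDerivAt g (deriv g (a + x * w)) (a + ((x : ℂ) + ((0 : ℝ) : ℂ) * I) * w) := by
      rw [hpt]; exact (hg x hx).differentiableAt.hasDerivAt
    have hc : HasDerivAt h (deriv g (a + x * w) * w) ((x : ℂ) + ((0 : ℝ) : ℂ) * I) :=
      hgd.comp ((x : ℂ) + ((0 : ℝ) : ℂ) * I) (haff _)
    rw [hc.deriv, mul_comm]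
  have key := Literature.Analysis.Complex.eq_mul_exp_integral_logDeriv (h := h) (y := 0)
    (zero_le_one (α := ℝ)) han hne
  have hint : ∫ x in (0 : ℝ)..1, deriv h ((x : ℂ) + ((0 : ℝ) : ℂ) * I) / h ((x : ℂ) + ((0 : ℝ) : ℂ) * I)
      = w * ∫ x in (0 : ℝ)..1, deriv g (a + x * w) / g (a + x * w) := by
    rw [← intervalIntegral.integral_const_mul]
    refine intervalIntegral.integral_congr (fun x hx => ?_)
    rw [uIcc_of_le zero_le_one] at hx
    show deriv h ((x : ℂ) + ((0 : ℝ) : ℂ) * I) / h ((x : ℂ) + ((0 : ℝ) : ℂ) * I)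
      = w * (deriv g (a + x * w) / g (a + x * w))
    rw [hder x hx, hval, mul_div_assoc]
  rw [hval, hval, hint] at key
  simpa using key

/-- **"`= exp{−2w log P + O(α𝓛)}`"**, the remainder made explicit: if `|g′/g(a+xw) − m| ≤ E` for
`x ∈ [0,1]` ((4.11) on the segment, `m = −2log P`), then `|w∫₀¹ g′/g(a+xw)dx − mw| ≤ E|w|`.
[cite: Zhang2022LandauSiegel, §4 Lemma 4.6 (proof)] -/
theorem norm_integral_sub_le {g : ℂ → ℂ} {a w m : ℂ} {E : ℝ}
    (hg : ∀ x ∈ Icc (0 : ℝ) 1, AnalyticAt ℂ g (a + x * w))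
    (h0 : ∀ x ∈ Icc (0 : ℝ) 1, g (a + x * w) ≠ 0)
    (hE : ∀ x ∈ Icc (0 : ℝ) 1, ‖deriv g (a + x * w) / g (a + x * w) - m‖ ≤ E) :
    ‖(w * ∫ x in (0 : ℝ)..1, deriv g (a + x * w) / g (a + x * w)) - m * w‖ ≤ E * ‖w‖ := by
  set f : ℝ → ℂ := fun x => deriv g (a + x * w) / g (a + x * w) with hf
  have hint : IntervalIntegrable f volume 0 1 :=
    (continuousOn_logDeriv_segment hg h0).intervalIntegrable_of_Icc zero_le_one
  have hsub : (w * ∫ x in (0 : ℝ)..1, f x) - m * w = w * ∫ x in (0 : ℝ)..1, (f x - m) := by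
    rw [intervalIntegral.integral_sub hint intervalIntegrable_const, intervalIntegral.integral_const]
    simp only [sub_zero, one_smul]
    ring
  rw [hsub, norm_mul]
  have hI : ‖∫ x in (0 : ℝ)..1, (f x - m)‖ ≤ E * |(1 : ℝ) - 0| := by
    refine intervalIntegral.norm_integral_le_of_norm_le_const fun x hx => ?_
    rw [uIoc_of_le zero_le_one] at hx
    exact hE x ⟨hx.1.le, hx.2⟩
  rw [sub_zero, abs_one, mul_one] at hI
  calc ‖w‖ * ‖∫ x in (0 : ℝ)..1, (f x - m)‖ ≤ ‖w‖ * E := mul_le_mul_of_nonneg_left hI (norm_nonneg _)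
    _ = E * ‖w‖ := mul_comm _ _

/-- **"`ℬ(1/2+iγ+w)/ℬ(ρ) = exp{−2w log P + O(α𝓛)}`"**: under the same hypotheses,
`g(a+w) = g(a)·e^{mw}·e^{η}` with `|η| ≤ E|w|`. [cite: Zhang2022LandauSiegel, §4 Lemma 4.6 (proof)] -/
theorem exists_eq_mul_exp {g : ℂ → ℂ} {a w m : ℂ} {E : ℝ}
    (hg : ∀ x ∈ Icc (0 : ℝ) 1, AnalyticAt ℂ g (a + x * w))
    (h0 : ∀ x ∈ Icc (0 : ℝ) 1, g (a + x * w) ≠ 0)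
    (hE : ∀ x ∈ Icc (0 : ℝ) 1, ‖deriv g (a + x * w) / g (a + x * w) - m‖ ≤ E) :
    ∃ η : ℂ, ‖η‖ ≤ E * ‖w‖ ∧ g (a + w) = g a * Complex.exp (m * w) * Complex.exp η := by
  refine ⟨(w * ∫ x in (0 : ℝ)..1, deriv g (a + x * w) / g (a + x * w)) - m * w,
    norm_integral_sub_le hg h0 hE, ?_⟩
  rw [eq_mul_exp_integral_logDeriv_segment hg h0, mul_assoc, ← Complex.exp_add]
  congr 2
  ring

/-- **"`= P^{−2w} + O(α𝓛)`"**: under the same hypotheses and `E|w| ≤ 1`,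
`|g(a+w) − g(a)e^{mw}| ≤ 2E|w|·|g(a)|·|e^{mw}|` (`|e^{η} − 1| ≤ 2|η|` for `|η| ≤ 1`).
[cite: Zhang2022LandauSiegel, §4 Lemma 4.6 (proof)] -/
theorem norm_sub_mul_exp_le {g : ℂ → ℂ} {a w m : ℂ} {E : ℝ}
    (hg : ∀ x ∈ Icc (0 : ℝ) 1, AnalyticAt ℂ g (a + x * w))
    (h0 : ∀ x ∈ Icc (0 : ℝ) 1, g (a + x * w) ≠ 0)
    (hE : ∀ x ∈ Icc (0 : ℝ) 1, ‖deriv g (a + x * w) / g (a + x * w) - m‖ ≤ E)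
    (hsmall : E * ‖w‖ ≤ 1) :
    ‖g (a + w) - g a * Complex.exp (m * w)‖
      ≤ ‖g a‖ * ‖Complex.exp (m * w)‖ * (2 * (E * ‖w‖)) := by
  obtain ⟨η, hη, heq⟩ := exists_eq_mul_exp hg h0 hE
  have hfac : g (a + w) - g a * Complex.exp (m * w)
      = (g a * Complex.exp (m * w)) * (Complex.exp η - 1) := by
    rw [heq]; ring
  rw [hfac, norm_mul, norm_mul]
  have h1 : ‖Complex.exp η - 1‖ ≤ 2 * ‖η‖ := Complex.norm_exp_sub_one_le (hη.trans hsmall)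
  have h2 : 2 * ‖η‖ ≤ 2 * (E * ‖w‖) := by linarith
  exact mul_le_mul_of_nonneg_left (h1.trans h2) (by positivity)

/-- With `m = −2log P` the main term is `e^{mw} = P^{−2w}` (`= exp(−2w log P)`, the tree's
`Zhang2022.Lemma46.Pw`), and for `|w| < 2α = 2π/log P` it is bounded: `|P^{−2w}| ≤ e^{4π}` — so the
remainder above is `O(α𝓛)` when `E = O(𝓛)`, `|w| < 2α`.
[cite: Zhang2022LandauSiegel, §4 Lemma 4.6 (proof)] -/
theorem norm_Pw_le_of_norm_lt {P : ℝ} (hP : 1 < P) {w : ℂ}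
    (hw : ‖w‖ < 2 * (Real.pi / Real.log P)) :
    ‖Complex.exp (-(2 * (Real.log P : ℂ)) * w)‖ ≤ Real.exp (4 * Real.pi) := by
  have hlog : 0 < Real.log P := Real.log_pos hP
  rw [Complex.norm_exp]
  apply Real.exp_le_exp.mpr
  have hre : (-(2 * (Real.log P : ℂ)) * w).re = -(2 * Real.log P * w.re) := by
    simp [Complex.mul_re]
  rw [hre]
  have h1 : |w.re| ≤ ‖w‖ := Complex.abs_re_le_norm w
  have h2 : -w.re ≤ ‖w‖ := (neg_le_abs _).trans h1
  have h3 : 2 * Real.log P * (-w.re) ≤ 2 * Real.log P * (2 * (Real.pi / Real.log P)) :=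
    mul_le_mul_of_nonneg_left (h2.trans hw.le) (by positivity)
  have h4 : 2 * Real.log P * (2 * (Real.pi / Real.log P)) = 4 * Real.pi := by
    field_simp
    ring
  linarith

/-! ### "(4.12) follows" -/

/-- **"Since `ℬ(ρ,ψ) = −1 + O(𝓛^{−100})` by (4.10)"**: at a zero `ρ` of `𝒜`, `|𝒜 − 1 − ℬ| ≤ E` gives
`|ℬ(ρ) + 1| ≤ E`. [cite: Zhang2022LandauSiegel, §4 Lemma 4.6 (proof)] -/
theorem norm_calB_add_one_le {Aρ Bρ : ℂ} {E : ℝ} (hA : Aρ = 0) (h410 : ‖Aρ - 1 - Bρ‖ ≤ E) :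
    ‖Bρ + 1‖ ≤ E := by
  have h : Bρ + 1 = -(Aρ - 1 - Bρ) := by rw [hA]; ring
  rw [h, norm_neg]
  exact h410

/-- **"the estimate (4.12) follows"** (assembly): with `p = P^{−2w}`, from `𝒜(ρ) = 0`, (4.10) at `ρ` and
at `ρ + w` (`|𝒜 − 1 − ℬ| ≤ E`), and the ratio estimate `|ℬ(ρ+w) − ℬ(ρ)p| ≤ R`, one gets
`|𝒜(ρ+w) − (1 − p)| ≤ E + R + E|p|` — i.e. `≪ α𝓛` once `E = O(𝓛^{−100})`, `R = O(α𝓛)`, `|p| ≤ e^{4π}`.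
[cite: Zhang2022LandauSiegel, §4 Lemma 4.6 (proof), (4.12)] -/
theorem ineq412_assembly {Aρ Bρ Aw Bw p : ℂ} {E R : ℝ} (hA : Aρ = 0)
    (h410ρ : ‖Aρ - 1 - Bρ‖ ≤ E) (h410w : ‖Aw - 1 - Bw‖ ≤ E) (hratio : ‖Bw - Bρ * p‖ ≤ R) :
    ‖Aw - (1 - p)‖ ≤ E + R + E * ‖p‖ := by
  have hB := norm_calB_add_one_le hA h410ρ
  have hsplit : Aw - (1 - p) = (Aw - 1 - Bw) + (Bw - Bρ * p) + (Bρ + 1) * p := by ring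
  rw [hsplit]
  calc ‖(Aw - 1 - Bw) + (Bw - Bρ * p) + (Bρ + 1) * p‖
      ≤ ‖(Aw - 1 - Bw) + (Bw - Bρ * p)‖ + ‖(Bρ + 1) * p‖ := norm_add_le _ _
    _ ≤ (‖Aw - 1 - Bw‖ + ‖Bw - Bρ * p‖) + ‖Bρ + 1‖ * ‖p‖ := by
        rw [norm_mul]; gcongr; exact norm_add_le _ _
    _ ≤ E + R + E * ‖p‖ := by
        gcongr

/-! ### (4.12) assembled: "`≪ α𝓛`, the implied constant being independent of `c′`" -/

/-- **(4.12) with its constant**: combine the (4.10) errors at `ρ` and `ρ + w` (`≤ E`), `𝒜(ρ) = 0`,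
the ratio step (`|ℬ′/ℬ + 2log P| ≤ C` on the segment — (4.11) —, `|w| < 2α`, `C·|w| ≤ 1`):
`|𝒜(ρ+w) − (1 − P^{−2w})| ≤ E·(1 + e^{4π}) + 2e^{4π}(1 + E)·C|w|` — with `E = O(𝓛^{−100})`,
`C = O(𝓛)`, `|w| < 2α` this is `≪ α𝓛`, and the constant involves only `C` and `e^{4π}`, not `c′`
("the implied constant being independent of `c′`"). Here `g` plays `ℬ(·,ψ)` along the segment
`ρ + xw`, `Aρ = 𝒜(ρ)`, `Aw = 𝒜(ρ+w)`. [cite: Zhang2022LandauSiegel, §4 Lemma 4.6 (proof), (4.12)] -/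
theorem ineq412 {g : ℂ → ℂ} {ρ w Aρ Aw : ℂ} {P E C : ℝ} (hP : 1 < P)
    (hg : ∀ x ∈ Icc (0 : ℝ) 1, AnalyticAt ℂ g (ρ + x * w))
    (h0 : ∀ x ∈ Icc (0 : ℝ) 1, g (ρ + x * w) ≠ 0)
    (hC : ∀ x ∈ Icc (0 : ℝ) 1,
      ‖deriv g (ρ + x * w) / g (ρ + x * w) - (-(2 * (Real.log P : ℂ)))‖ ≤ C)
    (hw : ‖w‖ < 2 * (Real.pi / Real.log P)) (hsmall : C * ‖w‖ ≤ 1) (hA : Aρ = 0)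
    (h410ρ : ‖Aρ - 1 - g ρ‖ ≤ E) (h410w : ‖Aw - 1 - g (ρ + w)‖ ≤ E) :
    ‖Aw - (1 - Complex.exp (-(2 * (Real.log P : ℂ)) * w))‖
      ≤ E * (1 + Real.exp (4 * Real.pi)) + 2 * Real.exp (4 * Real.pi) * (1 + E) * (C * ‖w‖) := by
  set p : ℂ := Complex.exp (-(2 * (Real.log P : ℂ)) * w) with hp
  have hE : 0 ≤ E := (norm_nonneg _).trans h410ρ
  have hpn : ‖p‖ ≤ Real.exp (4 * Real.pi) := norm_Pw_le_of_norm_lt hP hw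
  have hB1 : ‖g ρ + 1‖ ≤ E := norm_calB_add_one_le hA h410ρ
  have hBρ : ‖g ρ‖ ≤ 1 + E := by
    have := norm_add_le (g ρ + 1) (-1 : ℂ)
    rw [add_neg_cancel_right, norm_neg, norm_one] at this
    linarith
  have hratio : ‖g (ρ + w) - g ρ * p‖ ≤ ‖g ρ‖ * ‖p‖ * (2 * (C * ‖w‖)) :=
    norm_sub_mul_exp_le hg h0 hC hsmall
  have hR : ‖g ρ‖ * ‖p‖ * (2 * (C * ‖w‖)) ≤ (1 + E) * Real.exp (4 * Real.pi) * (2 * (C * ‖w‖)) := by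
    have hCw : 0 ≤ 2 * (C * ‖w‖) := by
      have : 0 ≤ C := le_trans (norm_nonneg _) (hC 0 ⟨le_rfl, zero_le_one⟩)
      positivity
    gcongr
  have hmain := ineq412_assembly (p := p) hA h410ρ h410w (hratio.trans hR)
  have hEp : E * ‖p‖ ≤ E * Real.exp (4 * Real.pi) := mul_le_mul_of_nonneg_left hpn hE
  calc ‖Aw - (1 - p)‖ ≤ E + (1 + E) * Real.exp (4 * Real.pi) * (2 * (C * ‖w‖)) + E * ‖p‖ := hmain
    _ ≤ E + (1 + E) * Real.exp (4 * Real.pi) * (2 * (C * ‖w‖)) + E * Real.exp (4 * Real.pi) := by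
        linarith
    _ = E * (1 + Real.exp (4 * Real.pi)) + 2 * Real.exp (4 * Real.pi) * (1 + E) * (C * ‖w‖) := by
        ring

end Lemma45

end Literature.NumberTheory.LFunctions.Zhang2022
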